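import Literature.MathematicalPhysics.QuantumFieldTheory.Balaban1983to89.B6V1TorusWitnessL0
import Literature.MathematicalPhysics.QuantumFieldTheory.Balaban1983to89.B6CubeWindowV1
import HarnessLib

/-!
# `Balaban1983to89.B6V1TorusWitnessL3` — SUB-ROW G-F3′-L0∕L3 (plan `lit-balaban-r03/G-F3L0-PLAN.md` §13 joint J13, §14): NON-VACUITY OF THE HYPOTHESIS SET OF
# THE L = 3 ENDPOINT `B6Cor28EntriesKLevelV1L3.cor28_kLevel_H_DH_L3` ([Balaban1984PropagatorsII] Cor. 2.8 (2.151) at k levels, `ℓ = 2`, `P′ ≥ 6`)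

statement-level skeleton of published theorems with citation tags; proofs where landed; nothing here is a claim about the Yang–Mills mass gap

T. Bałaban, *Propagators and renormalization transformations for lattice gauge theories. II*, Commun. Math. Phys. **96** (1984) 223–250
[Balaban1984PropagatorsII], (2.1)–(2.4) p. 224 («we admit the case when some domains Ω_j are equal to T_η»), (2.16) p. 225 (the weights), Prop. 2.2 p. 234
(«M is sufficiently large»).  The level-0 twin `B6V1TorusWitnessL0.v1Torus_nonvacuous` inhabits ROUTE V's torus datum with `P′_μ = 2L`, `R = 2L` beyond one
threshold; the endpoints of the k-level (2.136)/(2.142)/(2.149)/(2.151) chain bind MORE: `M_h = L^a ≥ 8`, `R ≥ 2L²`, `P′_μ ≥ 5` (`≥ 6` for the `_L3` form, where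
the canonical chart places every cube), TWO thresholds `M₂ ≤ L·M_h`, `N₁ + 1 ≤ R·L·M_h`, and positive weights in the global band (2.16) `GlobalBand b₀ b₁ c_f w`.
THIS FILE records, by the level-0 twin's two-top-level family (`exists_twoTop_TDomains`, `N0_V1`), that this larger set is inhabited for EVERY odd `L ≥ 3`,
every `k ≥ 2` and every pair of thresholds (`v1Torus_nonvacuous_thresholds`: `M_h := L^{⌈M₂⌉+3}`, `P′_μ := 2L`, `R := 2L² + N₁ + 1`, `m + K = k + a + 2`,
sites at both top levels), that the band is inhabited for every `0 < b₀ ≤ b₁`, `c_f ≠ 0` (`globalBand_nonvacuous`: `w_i := b₀(L^{j(i)})^{D}(c_f/L^{j(i)})²`),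
and the package at `ℓ = 2` in the binders of `cor28_kLevel_H_DH_L3` (`cor28_L3_hypotheses_nonvacuous`).  Theorems only; no `def`, no new fact; standard
axioms.  HONEST SCOPE: bookkeeping ((2.1)–(2.4), (2.16) as recorded by `TDomains`/`GlobalBand`); the witness family has exactly the two levels `k − 1, k`
((2.2) void for it); NOT summit progress.  Unit `lit-balaban-r03` (B6 fold owner, r03 gen 37), 2026-08-28; referee ref-4.
-/

namespace Literature.MathematicalPhysics.QuantumFieldTheory.Balaban1983to89.B6V1TorusWitnessL3

open Literature.MathematicalPhysics.QuantumFieldTheory.Balaban1983to89.B4Reflection242 (boxDom mem_boxDom blk)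
open Literature.MathematicalPhysics.QuantumFieldTheory.Balaban1983to89.B6MultiLevelBoxOperator (N0 bigSide one_le_bigSide)
open Literature.MathematicalPhysics.QuantumFieldTheory.Balaban1983to89.B6MultiLevelTorusOperatorL0 (TDomains)
open Literature.MathematicalPhysics.QuantumFieldTheory.Balaban1983to89.B6GlobalChartV1 (PV)
open Literature.MathematicalPhysics.QuantumFieldTheory.Balaban1983to89.B6GlobalChartV1L0 (domT)
open Literature.MathematicalPhysics.QuantumFieldTheory.Balaban1983to89.B6V1TorusWitness (N0_V1 topLev_zero topLev_corner corner_mem_boxDom)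
open Literature.MathematicalPhysics.QuantumFieldTheory.Balaban1983to89.B6V1TorusWitnessL0 (exists_twoTop_TDomains)
open Literature.MathematicalPhysics.QuantumFieldTheory.Balaban1983to89.B6SectAOperatorsV1 (BondIdx)
open Literature.MathematicalPhysics.QuantumFieldTheory.Balaban1983to89.B6CubeWindowV1 (GlobalBand)

variable {d : ℕ}

/-- `L^a` clears `8` and, times `L`, every real threshold (`L ≥ 2`, `a := ⌈M⌉ + 3`). [folklore] -/
private theorem exists_pow_ge' (ℓ : ℕ) (hℓ : 1 ≤ ℓ) (M : ℝ) :
    ∃ a : ℕ, 8 ≤ (ℓ + 1) ^ a ∧ M ≤ ((ℓ : ℝ) + 1) * (((ℓ + 1) ^ a : ℕ) : ℝ) := by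
  refine ⟨⌈M⌉₊ + 3, ?_, ?_⟩
  · calc 8 = 2 ^ 3 := by norm_num
      _ ≤ (ℓ + 1) ^ 3 := Nat.pow_le_pow_left (by omega) 3
      _ ≤ (ℓ + 1) ^ (⌈M⌉₊ + 3) := Nat.pow_le_pow_right (by omega) (by omega)
  · have h1 : M ≤ (⌈M⌉₊ : ℝ) := Nat.le_ceil M
    have h2 : (⌈M⌉₊ : ℕ) ≤ (ℓ + 1) ^ ⌈M⌉₊ := (Nat.lt_pow_self (by omega : 1 < ℓ + 1)).le
    have h3 : ((ℓ + 1) ^ ⌈M⌉₊ : ℕ) ≤ (ℓ + 1) ^ (⌈M⌉₊ + 3) := Nat.pow_le_pow_right (by omega) (by omega)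
    have h4 : ((ℓ + 1) ^ (⌈M⌉₊ + 3) : ℕ) ≤ (ℓ + 1) * (ℓ + 1) ^ (⌈M⌉₊ + 3) := Nat.le_mul_of_pos_left _ (by omega)
    have h5 : (⌈M⌉₊ : ℝ) ≤ (((ℓ + 1) * (ℓ + 1) ^ (⌈M⌉₊ + 3) : ℕ) : ℝ) := by exact_mod_cast h2.trans (h3.trans h4)
    calc M ≤ (⌈M⌉₊ : ℝ) := h1
      _ ≤ (((ℓ + 1) * (ℓ + 1) ^ (⌈M⌉₊ + 3) : ℕ) : ℝ) := h5
      _ = ((ℓ : ℝ) + 1) * (((ℓ + 1) ^ (⌈M⌉₊ + 3) : ℕ) : ℝ) := by push_cast; ring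

/-- **NON-VACUITY OF ROUTE V'S TORUS DATUM WITH THE k-LEVEL SIDE CONDITIONS AND BOTH THRESHOLDS, FOR EVERY ODD `L ≥ 3`**: for every `k ≥ 2`,
`M₂`, `N₁` there are V1 parameters `m, K` and a nested torus family `D : TDomains d ℓ M_h k P′ R` whose torus IS the V1 torus (`hN`), with `k ≤ m + K`,
`M_h = L^a ≥ 8`, `R ≥ 2L²`, `P′_μ = 2L ≥ 6`, `M₂ ≤ L·M_h`, `N₁ + 1 ≤ R·L·M_h`, and sites at BOTH top levels `k`, `k − 1` (the two-top-level family of the level-0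
twin, (2.2) void). [cite: Balaban1984PropagatorsII, (2.1)–(2.4) p.224 («we admit the case when some domains Ω_j are equal to T_η»), Prop. 2.2 p.234 («M is sufficiently large»)] -/
theorem v1Torus_nonvacuous_thresholds (d ℓ k : ℕ) (hd : 1 ≤ d + 1) (hL : Odd (ℓ + 1) ∧ 1 < ℓ + 1) (hk : 2 ≤ k) (M₂ : ℝ) (N₁ : ℕ) :
    ∃ (a m K Mh R : ℕ) (P' : Fin (d + 1) → ℕ) (D : B6MultiLevelTorusOperatorL0.TDomains d ℓ Mh k P' R),
      (∀ μ, N0 ℓ Mh k P' μ = (PV d ℓ m K hd hL).sitesPerDir 0) ∧ k ≤ m + K ∧ Mh = (ℓ + 1) ^ a ∧ 8 ≤ Mh ∧ 2 * (ℓ + 1) ^ 2 ≤ R ∧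
      (∀ μ, 2 * (ℓ + 1) ≤ P' μ) ∧ M₂ ≤ ((ℓ : ℝ) + 1) * Mh ∧ N₁ + 1 ≤ R * ((ℓ + 1) * Mh) ∧
      (∃ x ∈ boxDom (N0 ℓ Mh k P'), D.lev x = k) ∧ (∃ x ∈ boxDom (N0 ℓ Mh k P'), D.lev x = k - 1) := by
  have hℓ : 1 ≤ ℓ := by have := hL.2; omega
  obtain ⟨a, h8, ha⟩ := exists_pow_ge' ℓ hℓ M₂
  have hMh : 1 ≤ (ℓ + 1) ^ a := Nat.one_le_pow _ _ (by omega)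
  have hP2 : ∀ μ : Fin (d + 1), 2 ≤ (fun _ : Fin (d + 1) => 2 * (ℓ + 1)) μ := fun μ => by simp only; omega
  set R : ℕ := 2 * (ℓ + 1) ^ 2 + N₁ + 1 with hR
  obtain ⟨D, hD⟩ := exists_twoTop_TDomains d ℓ ((ℓ + 1) ^ a) k (fun _ => 2 * (ℓ + 1)) R hk
  refine ⟨a, k + a + 2, 0, (ℓ + 1) ^ a, R, fun _ => 2 * (ℓ + 1), D, fun μ => N0_V1 ℓ k a (k + a + 2) 0 hd hL rfl μ,
    by omega, rfl, h8, by omega, fun μ => le_rfl, ha, ?_, ?_, ?_⟩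
  · have h1 : 1 ≤ (ℓ + 1) * (ℓ + 1) ^ a := Nat.le_mul_of_pos_left _ (by omega) |>.trans' hMh
    calc N₁ + 1 ≤ R := by omega
      _ = R * 1 := (mul_one R).symm
      _ ≤ R * ((ℓ + 1) * (ℓ + 1) ^ a) := Nat.mul_le_mul_left R h1
  · refine ⟨0, ?_, by rw [hD]; exact topLev_zero ℓ k _⟩
    rw [mem_boxDom]; intro μ
    have := B6MultiLevelTorusOperator.one_le_N0 (ℓ := ℓ) (k := k) hMh (fun μ => le_trans (by norm_num) (hP2 μ)) μ
    simp only [Pi.zero_apply]; exact ⟨le_rfl, by exact_mod_cast this⟩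
  · exact ⟨_, corner_mem_boxDom ℓ k _ _ hMh hP2, by rw [hD]; exact topLev_corner ℓ k _ hMh⟩

/-- **THE GLOBAL BAND (2.16) IS INHABITED BY POSITIVE WEIGHTS** for every `0 < b₀ ≤ b₁`, `c_f ≠ 0`, on every index family: `w_i := b₀·(L^{j(i)})^{D}·(c_f/L^{j(i)})²`
(the lower edge of the band). [cite: Balaban1984PropagatorsII, (2.16) p.225 («γ₀a ≤ a_j(L^jη)^{−2} ≤ γ₁a»), bookkeeping] -/
theorem globalBand_nonvacuous {ℓ m K : ℕ} {hd : 1 ≤ d + 1} {hL : Odd (ℓ + 1) ∧ 1 < ℓ + 1} {Dm : B6SectADomainsV1.Domains (PV d ℓ m K hd hL)}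
    {b₀ b₁ cf : ℝ} (hb₀ : 0 < b₀) (hb₁ : b₀ ≤ b₁) (hcf : cf ≠ 0) :
    ∃ w : BondIdx Dm → ℝ, (∀ i, 0 < w i) ∧ GlobalBand b₀ b₁ cf w := by
  refine ⟨fun i => b₀ * ((((ℓ + 1 : ℕ) : ℝ)) ^ (i.1.1 : ℕ)) ^ (d + 1) * (cf / (((ℓ + 1 : ℕ) : ℝ) ^ (i.1.1 : ℕ))) ^ 2,
    fun i => ?_, fun i => ?_⟩
  · have hq : cf / (((ℓ + 1 : ℕ) : ℝ) ^ (i.1.1 : ℕ)) ≠ 0 := div_ne_zero hcf (by positivity)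
    positivity
  · have hq : cf / (((ℓ + 1 : ℕ) : ℝ) ^ (i.1.1 : ℕ)) ≠ 0 := div_ne_zero hcf (by positivity)
    have hq2 : (cf / (((ℓ + 1 : ℕ) : ℝ) ^ (i.1.1 : ℕ))) ^ 2 ≠ 0 := pow_ne_zero 2 hq
    have e : b₀ * ((((ℓ + 1 : ℕ) : ℝ)) ^ (i.1.1 : ℕ)) ^ (d + 1) * (cf / (((ℓ + 1 : ℕ) : ℝ) ^ (i.1.1 : ℕ))) ^ 2 /
        (cf / (((ℓ + 1 : ℕ) : ℝ) ^ (i.1.1 : ℕ))) ^ 2 = b₀ * ((((ℓ + 1 : ℕ) : ℝ)) ^ (i.1.1 : ℕ)) ^ (d + 1) := by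
      rw [mul_div_assoc, div_self hq2, mul_one]
    simp only
    rw [e]
    exact ⟨le_rfl, mul_le_mul_of_nonneg_right hb₁ (by positivity)⟩

/-- **THE HYPOTHESIS SET OF `B6Cor28EntriesKLevelV1L3.cor28_kLevel_H_DH_L3` IS INHABITED** (`ℓ = 2`, i.e. `L = 3`): for every `k ≥ 2`, every pair of thresholds
`M₂`, `N₁` and every band `0 < b₀ ≤ b₁`, `c_f ≠ 0`, there are `a m K M_h R P′`, a torus family `D` with `hN`, `hk : k ≤ m + K`, `M_h = 3^a ≥ 8`, `R ≥ 2·3²`,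
`P′_μ ≥ 6`, `M₂ ≤ 3·M_h`, `N₁ + 1 ≤ R·3·M_h`, sites at both top levels, and positive weights `w` on the index bonds of `domT hN D hk` in `GlobalBand b₀ b₁ c_f`.
[cite: Balaban1984PropagatorsII, (2.1)–(2.4) p.224, (2.16) p.225, Prop. 2.2 p.234, bookkeeping] -/
theorem cor28_L3_hypotheses_nonvacuous (d k : ℕ) (hd : 1 ≤ d + 1) (hL : Odd (2 + 1) ∧ 1 < 2 + 1) (hk : 2 ≤ k) (M₂ : ℝ) (N₁ : ℕ)
    {b₀ b₁ cf : ℝ} (hb₀ : 0 < b₀) (hb₁ : b₀ ≤ b₁) (hcf : cf ≠ 0) :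
    ∃ (a m K Mh R : ℕ) (P' : Fin (d + 1) → ℕ) (D : B6MultiLevelTorusOperatorL0.TDomains d 2 Mh k P' R)
      (hN : ∀ μ, N0 2 Mh k P' μ = (PV d 2 m K hd hL).sitesPerDir 0) (hk' : k ≤ m + K),
      Mh = (2 + 1) ^ a ∧ 8 ≤ Mh ∧ 2 * (2 + 1) ^ 2 ≤ R ∧ (∀ μ, 6 ≤ P' μ) ∧ M₂ ≤ (((2 : ℕ) : ℝ) + 1) * Mh ∧ N₁ + 1 ≤ R * ((2 + 1) * Mh) ∧
      (∃ x ∈ boxDom (N0 2 Mh k P'), D.lev x = k) ∧ (∃ x ∈ boxDom (N0 2 Mh k P'), D.lev x = k - 1) ∧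
      ∃ w : BondIdx (domT hN D hk') → ℝ, (∀ i, 0 < w i) ∧ GlobalBand b₀ b₁ cf w := by
  obtain ⟨a, m, K, Mh, R, P', D, hN, hkm, hMha, h8, hR, hP, hM, hN₁, hx, hx'⟩ := v1Torus_nonvacuous_thresholds d 2 k hd hL hk M₂ N₁
  obtain ⟨w, hw, hB⟩ := globalBand_nonvacuous (Dm := domT hN D hkm) hb₀ hb₁ hcf
  exact ⟨a, m, K, Mh, R, P', D, hN, hkm, hMha, h8, hR, fun μ => le_trans (by norm_num) (hP μ), by push_cast at hM ⊢; exact hM, hN₁, hx, hx', w, hw, hB⟩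

end Literature.MathematicalPhysics.QuantumFieldTheory.Balaban1983to89.B6V1TorusWitnessL3
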